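import Literature.NumberTheory.EllipticCurves.KatoAdditiveTwistedValueNeronIntegralityThree
import Literature.NumberTheory.EllipticCurves.CongruentNumberCurveHeckeSeries
import Literature.NumberTheory.EllipticCurves.CongruentNumberCurveJacobiSums
import Literature.NumberTheory.QuadraticFields.GaussianQuarticSymbol
import HarnessLib

/-!
# STUB-PLAN one level down for P1b `stub_quarticThetaDictionary` of the line of record `rubin_e1_inert_three`
# (crux `InertBadAtThree`, stmt-BirchSwinnertonDyer-19225) — ideator bsd-idea-18 g9, lens = transfer (publish-only), v2

BSD is NOT proved here; crux 19225 is NOT closed; NO stub of the registered skeleton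
(`Lines/rubin_e1_inert_three.lean` v5, sha16 cf92aff39960433f — untouched, no `skeleton check` run) is proved by
this file.  This is a non-registered crux workfile (`ledger crux write`), companion of
`STUB-PLAN-quarticThetaDictionary-bsd-idea-18-g9.md`; it refines the largest piece (P1b, size L) of the g8 plan
`QUARTIC_STUB_PLAN_bsd_idea_18_g8.lean` / `STUB-PLAN-neronIntegralThreeQuartic-bsd-idea-18-g8.md` into eleven
`stub_*` lemmas of size S–M and a sorry-free composition `quarticThetaDictionary` whose statement is the g8
interface `stub_quarticThetaDictionary` VERBATIM (with this file's copy of the `ℂ`-valued `quarticCharThree`, same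
body), so that P6 (`stub_clean_of_dictionary`) consumes it unchanged.

v2 (this version) is written AGAINST THE LANDED BRIDGE FILE of width seat bsd-wall-cm-bed-w4 g9,
`Literature/NumberTheory/QuadraticFields/GaussianQuarticSymbol.lean` (p629658, commit 1bb4d93b4bff): the quartic symbol
is the CONCRETE `GaussianQuarticSymbol.quarticSymbolInt D x = (D/x)₄ ∈ ℤ[i]` (no `∃ φ`), two of the six interface fields
are discharged here from that file (`quarticSymbolInt_one`, `quarticSymbolInt_mul`), the `3`-adic symbol is the tree's
`GaussianQuarticSymbol.quarticCharThree` (`ℤ[i]`-valued; `toComplex_quarticCharThree` identifies it with P6's `ℂ`-valued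
copy), and the remaining stubs are labelled with the file of w4's announced programme (bsd-wall STATUS 11:35:18Z) that
discharges them: `…Values` (Q1b, Q1c, Q2), File B `QuarticTwistLSeriesCoefficients` (Q5, Q6), File C (Q7, Q8a–c),
File D (= the composition proved below).  v1 (same subpath, commit df103a67659d) had an abstract `∃ φ, QuarticCharSpec A φ`.

TRANSFER (the lens): the solved sibling is the `D = n²` dictionary `Literature/NumberTheory/EllipticCurves/
CongruentNumberCurveHeckeSeries.lean` (`heckePsi`, `heckePsi_add_mul`, `coeff_heckePsi`,
`lFunction_congruentNumberCurve_eq_jacobiSym_mul_primarySum`, `lSeries_congruentNumberCurve_eq`), ported decl by decl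
to a general fourth-power-free `D` with `3 ∣ D` (Ireland–Rosen Ch. 18 §6 Thm 7).  The two non-transferring steps:
(Q1) for `D ≠ n²` the weight `\overline{(D/x̃)₄}` depends on `x̃`, not on `N x` alone, so `jacobiSym n (N x)` is
replaced by `(D/·)₄ = quarticSymbolInt D` on primary elements, with the interface `QuarticCharSpec D` (multiplicative,
`star`-equivariant, pinned at primary primes by the tree's `GaussianQuartic.chi` = the currency of
`IrelandRosen1990_card_points_one_mod_four_holds`, `= [q ∤ D]` at `−q`, PERIODIC mod `8|D|`);
(Q2) the `3`-splitting `D = (−3)^k A`, `3 ∤ A`, needed ONLY on the period side: `(D/x̃)₄ = (−3/x̃)₄^k (A/x̃)₄`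
(landed: `quarticSymbolInt_pow_left`, `_mul_left`) and `(−3/x̃)₄ = (x̃/3)₄ = quarticCharThree x̃` — Prop. 9.9.8 with
`a = −3 ≡ 1 (4)` (landed: `map_quarticSymbolInt_of_isPrimary`) plus Euler's criterion at `3` (landed:
`three_dvd_sq_sub_quarticCharThree`) — so that `Ψ_D = \overline{(·/3)₄}^k · Ψ'` POINTWISE with `Ψ'` of `3`-FREE period
`M' = 8|A|m` (P1b demands `¬ 3 ∣ M'`; the naive period `8|D|m` of `Ψ_D` is divisible by `3`).

Sizes: Q1a M− · Q1b M− · Q1c S · Q1d S–M · Q2 S–M · Q3 M · Q4 M · Q5 M+ · Q6 S–M · Q7 M− · Q8a M− · Q8b S · Q8c S–M;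
proved here: `toComplex_quarticCharThree`, `quarticCharSpec_quarticSymbolInt` (from Q1a–d), `exists_eq_neg_three_pow_mul`,
`twistedLSeries_eq_theta` (Q9), `quarticThetaDictionary` (composition).  `lean check`: rc 0, sorries only inside `stub_*`.
-/

noncomputable section

open scoped MatrixGroups ModularForm ComplexConjugate
open CongruenceSubgroup
open Literature.NumberTheory.QuadraticFields Literature.NumberTheory.QuadraticFields.GaussianPrimary
  Literature.NumberTheory.EllipticCurves.GaussianPrimary Literature.NumberTheory.EllipticCurves.GaussianQuartic
  Literature.NumberTheory.EllipticCurves.ModularForms Literature.NumberTheory.LFunctions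

namespace Summit.BirchSwinnertonDyer.BirchSwinnertonDyer.Cruxes.InertBadAtThree.RubinE1InertThree.QuarticDictionary

/-! ## §0 Objects -/

/-- The quartic symbol at the inert prime `3` read in `ℂ` — VERBATIM the g8 `QuarticPlan.quarticCharThree` (P6's `3`-adic
weight); equal to the tree's `ℤ[i]`-valued `GaussianQuarticSymbol.quarticCharThree` under `toComplex`
(`toComplex_quarticCharThree`). -/
def quarticCharThree (c : GaussianInt) : ℂ :=
  if (3 : ℤ) ∣ c.re ∧ (3 : ℤ) ∣ c.im then 0
  else if (3 : ℤ) ∣ c.im then 1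
  else if (3 : ℤ) ∣ c.re then -1
  else if (3 : ℤ) ∣ c.re - c.im then -Complex.I
  else Complex.I

/-- The two copies of `(·/3)₄` agree. -/
theorem toComplex_quarticCharThree (c : GaussianInt) :
    ((GaussianQuarticSymbol.quarticCharThree c : GaussianInt) : ℂ) = quarticCharThree c := by
  unfold GaussianQuarticSymbol.quarticCharThree quarticCharThree
  split_ifs <;> simp [GaussianInt.toComplex_def']

/-- **The `ℤ[i]`-currency interface of `x ↦ (A/x)₄` on primary `x`** (what the ported template consumes).  `φ` is
multiplicative and `star`-equivariant on primary elements; at a primary prime `π` of norm `p ≡ 1 (4)` it is the tree's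
quartic character value `χ_π(A mod p)` (`GaussianQuartic.chi`, `= 0` iff `p ∣ A`) — the currency of
`IrelandRosen1990_card_points_one_mod_four_holds`; at the primary generator `−q` of an inert prime `q ≡ 3 (4)` it is `1`
(`(A/q)₄ = 1`) resp. `0` if `q ∣ A`; and it is periodic modulo `8|A|` on primary arguments (Thm 18.7: «`α ≡ 1 (8D)` implies
`(D/α)₄ = 1`»; for `x` sharing a prime with `A` both sides are `0`).  Values off the primary elements are unconstrained.
[cite: IrelandRosen1990, Ch. 18 §6, Theorem 7] -/
structure QuarticCharSpec (A : ℤ) (φ : GaussianInt → GaussianInt) : Prop where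
  map_one : φ 1 = 1
  map_mul : ∀ x y : GaussianInt, IsPrimary x → IsPrimary y → φ (x * y) = φ x * φ y
  map_star : ∀ x : GaussianInt, IsPrimary x → φ (star x) = star (φ x)
  split : ∀ (p : ℕ) [Fact p.Prime] (hp1 : p % 4 = 1) (π : GaussianInt) (_ : IsPrimary π) (hπp : π.norm = p),
    φ π = chi hp1 hπp (A : ZMod p)
  inert : ∀ q : ℕ, q.Prime → q % 4 = 3 → φ (-(q : GaussianInt)) = if (q : ℤ) ∣ A then 0 else 1
  periodic : ∀ x y : GaussianInt, IsPrimary x → φ (x + ((8 * |A| : ℤ) : GaussianInt) * y) = φ x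

/-- **The twisted primary sum `T_φ(n) = Σ_{x primary, N x = n} \overline{φ(x)} · x`** — the `n`-th coefficient of
Ireland–Rosen's `L(s, χ)`, `χ((x)) = \overline{(D/x̃)₄} x̃` (replaces the template's `jacobiSym n m * primarySum m`).
[cite: IrelandRosen1990, Ch. 18 §6, Theorem 7] -/
def twistedPrimarySum (φ : GaussianInt → GaussianInt) (n : ℕ) : GaussianInt :=
  ∑ x ∈ primaryNormEq n, star (φ x) * x

/-- **The theta coefficient `Ψ_{φ,χ'}(x) = χ'(N x) · \overline{φ(x̃)} · u(x)`** (`x̃ = u(x) x` the primary associate,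
`u(x) = 0` for `1 + i ∣ x`) — the port of the template's `heckePsi n x = (n / N x) · u(x)` with the extra Dirichlet twist
`χ'` (for us `χ' = χ⁻¹`). [cite: IrelandRosen1990, Ch. 18 §6, Theorem 7] -/
def psi (φ : GaussianInt → GaussianInt) {m : ℕ} (χ' : DirichletCharacter ℂ m) (x : GaussianInt) : ℂ :=
  χ' ((x.norm : ℤ) : ZMod m) * ((star (φ (primary x)) * primaryUnit x : GaussianInt) : ℂ)

/-- **The `3`-free part `Ψ'_{φ,k,χ'}(x) = (u(x)/3)₄^k · Ψ_{φ,χ'}(x)`** (`(u/3)₄ = u² ∈ {0, 1, −1}`): with `φ = (A/·)₄` this is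
the `Ψ'` of the g8 interface, `Ψ_{(D/·)₄} = \overline{(·/3)₄}^k · Ψ'` pointwise for `D = (−3)^k A` (`stub_psi_threeSplit`). -/
def psi' (φ : GaussianInt → GaussianInt) (k : ℕ) {m : ℕ} (χ' : DirichletCharacter ℂ m) (x : GaussianInt) : ℂ :=
  ((GaussianQuarticSymbol.quarticCharThree (primaryUnit x) : GaussianInt) : ℂ) ^ k * psi φ χ' x

/-- The quartic model `E_D : y² = x³ − D x`. -/
def quarticModel (D : ℤ) : WeierstrassCurve ℚ := ⟨0, 0, 0, -(D : ℚ), 0⟩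

/-! ## §1 The interface fields of `(D/·)₄ = quarticSymbolInt D` (Q1a–d; two fields are landed) and the `3`-symbol (Q2) -/

/-- **Q1a `stub_quarticSymbolInt_star` (M−): `(D/x̄)₄ = \overline{(D/x)₄}` for primary `x`** — Prop. 9.8.3 (c)
`χ_λ̄(ᾱ) = \overline{χ_λ(α)}` with `α = D = D̄`, prime by prime; tree, `𝓞 K` currency: `galRestrict_quarticResidueSymbol` /
`quarticResidueSymbol_conj_place` (transport through `Φ₄`, `Φ₄ ∘ star = galConj ∘ Φ₄`), or directly from Euler's criterion
`π̄ ∣ D^{(p−1)/4} − \overline{χ_π(D)}` + uniqueness.  w4 file: `…Values`. Why it might fail: it does not.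
[cite: IrelandRosen1990, Ch. 9 §8, Prop. 9.8.3 (c)] -/
theorem stub_quarticSymbolInt_star (D : ℤ) {x : GaussianInt} (hx : IsPrimary x) :
    GaussianQuarticSymbol.quarticSymbolInt D (star x) = star (GaussianQuarticSymbol.quarticSymbolInt D x) := by
  sorry

/-- **Q1b `stub_quarticSymbolInt_split` (M−): at a primary prime `π` of norm `p ≡ 1 (4)`, `(D/π)₄ = χ_π(D mod p)` in the
currency `GaussianQuartic.chi` of `IrelandRosen1990_card_points_one_mod_four_holds`** — tree: the bridge lemma
`GaussianIntRingOfIntegers.map_chi_red_eq_quarticResidueSymbol` (any `e : GaussianInt ≃+* 𝓞 K` with `e i = ζ`; take `Φ₄`,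
`toRingOfIntegers_I`) + `quarticSymbol_span_of_span_eq` + `GaussianQuartic.red_intCast`.  w4 file: `…Values` («Euler
criterion + uniqueness at split π»). Why it might fail: it does not. [cite: IrelandRosen1990, Ch. 9 §8, Prop. 9.8.2] -/
theorem stub_quarticSymbolInt_split (D : ℤ) (p : ℕ) [Fact p.Prime] (hp1 : p % 4 = 1) (π : GaussianInt)
    (hπ : IsPrimary π) (hπp : π.norm = p) :
    GaussianQuarticSymbol.quarticSymbolInt D π = chi hp1 hπp (D : ZMod p) := by
  sorry

/-- **Q1c `stub_quarticSymbolInt_inert` (S): `(D/q)₄ = 1` for an inert prime `q ≡ 3 (4)`, `q ∤ D`, and `= 0` if `q ∣ D`**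
— tree: `QuarticSymbolModulus.quarticSymbol_span_natCast_intCast_eq_one_of_mod_four_eq_three` (Ch. 18 §6 Lemma),
`quarticSymbolInt_isUnit_mul` (`−q` vs `q`); the `q ∣ D` case is `χ_{(q)}(0) = 0` (`quarticResidueSymbol` at `0`).
w4 file: `…Values`. Why it might fail: it does not. [cite: IrelandRosen1990, Ch. 18 §6, Lemma] -/
theorem stub_quarticSymbolInt_inert (D : ℤ) (q : ℕ) (hq : q.Prime) (hq3 : q % 4 = 3) :
    GaussianQuarticSymbol.quarticSymbolInt D (-(q : GaussianInt)) = if (q : ℤ) ∣ D then 0 else 1 := by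
  sorry

/-- **Q1d `stub_quarticSymbolInt_periodic` (S–M): `(D/·)₄` is periodic mod `8|D|` on primary arguments** — coprime case
LANDED: `GaussianQuarticSymbol.quarticSymbolInt_eq_of_dvd_sub` (`x + 8|D|y ≠ 0` as it is `≡ x ≡ 1 (2+2i)`); non-coprime
case: a prime `λ ∣ (x, D)` divides `x + 8|D|y` too and kills both sides (`quarticSymbolInt_mul` + Q1b/Q1c value `0`).
Why it might fail: it does not. [cite: IrelandRosen1990, Ch. 18 §6, Theorem 7 (proof)] -/
theorem stub_quarticSymbolInt_periodic {D : ℤ} (hD : D ≠ 0) {x : GaussianInt} (hx : IsPrimary x) (y : GaussianInt) :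
    GaussianQuarticSymbol.quarticSymbolInt D (x + ((8 * |D| : ℤ) : GaussianInt) * y) =
      GaussianQuarticSymbol.quarticSymbolInt D x := by
  sorry

/-- **The interface holds for the concrete symbol `(D/·)₄ = quarticSymbolInt D`, `D ≠ 0`** (from Q1a–d; `map_one`,
`map_mul` are the landed `quarticSymbolInt_one`, `quarticSymbolInt_mul`). -/
theorem quarticCharSpec_quarticSymbolInt {D : ℤ} (hD : D ≠ 0) :
    QuarticCharSpec D (GaussianQuarticSymbol.quarticSymbolInt D) where
  map_one := GaussianQuarticSymbol.quarticSymbolInt_one D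
  map_mul _ _ hx hy := GaussianQuarticSymbol.quarticSymbolInt_mul D hx.ne_zero hy.ne_zero
  map_star _ hx := stub_quarticSymbolInt_star D hx
  split p _ hp1 π hπ hπp := stub_quarticSymbolInt_split D p hp1 π hπ hπp
  inert q hq hq3 := stub_quarticSymbolInt_inert D q hq hq3
  periodic _ y hx := stub_quarticSymbolInt_periodic hD hx y

/-- **Q2 `stub_quarticSymbolInt_neg_three` (S–M): `(−3/x)₄ = (x/3)₄ = quarticCharThree x` for primary `x`** — Prop. 9.9.8
with `a = −3 ≡ 1 (4)`, LANDED as `GaussianQuarticSymbol.map_quarticSymbolInt_of_isPrimary` (`Φ₄((−3/x)₄) = χ_{(−3)}(Φ₄ x)`,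
coprime case), then Euler's criterion mod the prime `3` of `𝓞 K` (`quarticResidueSymbol_spec`, `N(3) = 9`) against the table
(`three_dvd_sq_sub_quarticCharThree`, landed) and uniqueness of fourth roots of unity mod `3`
(`quarticResidueSymbol_eq_of_pow_four_eq_one`); for `3 ∣ x` both sides are `0` (`quarticCharThree_eq_zero_iff`).  (Equivalently
IR 9.9.6 at `q = 3` prime by prime: `QuarticReciprocity.natCast_dvd_pow_sub_chi_neg` + `quarticCharThree_mul`.)  w4 file:
`…Values` («(−3/x)₄ = (x/3)₄ = quarticCharThree x for primary x»). Why it might fail: it does not.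
[cite: IrelandRosen1990, Ch. 9 §9, Prop. 9.9.8] -/
theorem stub_quarticSymbolInt_neg_three {x : GaussianInt} (hx : IsPrimary x) :
    GaussianQuarticSymbol.quarticSymbolInt (-3) x = GaussianQuarticSymbol.quarticCharThree x := by
  sorry

/-! ## §2 The template, ported (`jacobiSym n (N x)` ↦ `star (φ x̃)`) -/

/-- **Q3 `stub_twistedPrimarySum_mul_of_coprime` (M): `T_φ(n n') = T_φ(n) T_φ(n')` for coprime `n, n'`** — port of
`primarySum_mul_of_coprime` (the bijection `(x, y) ↦ x y : primaryNormEq n × primaryNormEq n' → primaryNormEq (n n')`,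
unique factorisation in `ℤ[i]`), the weights multiplying by `QuarticCharSpec.map_mul`.  w4 file: B. Why it might fail: it
does not; ~140 template lines. [cite: IrelandRosen1990, Ch. 18 §6, proof of Theorem 7] -/
theorem stub_twistedPrimarySum_mul_of_coprime {A : ℤ} {φ : GaussianInt → GaussianInt} (hφ : QuarticCharSpec A φ)
    {n n' : ℕ} (h : n.Coprime n') :
    twistedPrimarySum φ (n * n') = twistedPrimarySum φ n * twistedPrimarySum φ n' := by
  sorry

/-- **Q4 `stub_twistedPrimarySum_prime_pow` (M): the prime-power values of `T_φ`** — port of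
`primarySum_pow_of_mod_four_eq_three/one` (`primaryNormEq (q^{2j}) = {(−q)^j}`, `primaryNormEq (q^{2j+1}) = ∅`,
`primaryNormEq (p^j) = {π^i π̄^{j−i}}`) with the weights from `QuarticCharSpec` (`inert`, `split`, `map_star`, `map_mul`;
`χ_π(0) = 0` at `p ∣ A`; even norms have no primary elements).  w4 file: B. [cite: IrelandRosen1990, Ch. 18 §6, proof of Theorem 7] -/
theorem stub_twistedPrimarySum_prime_pow {A : ℤ} {φ : GaussianInt → GaussianInt} (hφ : QuarticCharSpec A φ) :
    (∀ (q : ℕ) [Fact q.Prime], q % 4 = 3 → ¬ (q : ℤ) ∣ A → ∀ j : ℕ,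
        twistedPrimarySum φ (q ^ (2 * j)) = (-(q : GaussianInt)) ^ j ∧ twistedPrimarySum φ (q ^ (2 * j + 1)) = 0) ∧
      (∀ (p : ℕ), p.Prime → (p : ℤ) ∣ 2 * A → ∀ j : ℕ, twistedPrimarySum φ (p ^ (j + 1)) = 0) ∧
      (∀ (p : ℕ) [Fact p.Prime] (hp1 : p % 4 = 1), ¬ (p : ℤ) ∣ A →
        ∀ (π : GaussianInt), IsPrimary π → ∀ (hπp : π.norm = p) (j : ℕ),
          twistedPrimarySum φ (p ^ j) =
            ∑ i ∈ Finset.range (j + 1),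
              (star (chi hp1 hπp (A : ZMod p)) * π) ^ i * (chi hp1 hπp (A : ZMod p) * star π) ^ (j - i)) := by
  sorry

/-- **Q5 `stub_lFunction_quarticModel_prime_pow` (M+): the prime-power Dirichlet coefficients of `E_D : y² = x³ − Dx`,
`D ≠ 0` fourth-power-free** — port of the template's §Coefficients: (a) `p ∣ 2D` is additive
(`hasAdditiveReductionAt_two_mk_pow_mul_odd` with `−D = 2^r A₀`, `r = v₂(D) < 4`; at odd `p ∣ D`:
`hasAdditiveReductionAt_of_valuation`, `v_p(Δ) = 3 v_p(D) ∈ {3,6,9}`, `v_p(c₄) ≥ 1`, `Δ(E_D) = 64 D³`, `c₄ = 48 D`), then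
`lFunction_apply_eq_zero_of_hasAdditiveReductionAt` + `LFunction_apply_prime_pow_add_two`; (b) `p ≡ 3 (4)`, `p ∤ D`:
`a_p = 0` (`lFunction_map_apply_prime_of_not_dvd` + `IrelandRosen1990_card_points_three_mod_four`), good reduction
(`hasGoodReductionAt_map_of_not_dvd`), recursion; (c) `p ≡ 1 (4)`, `p ∤ D`, `π` primary of norm `p`, `c = χ_π(D)`:
`a_p = c̄ π + c π̄` (`IrelandRosen1990_card_points_one_mod_four_holds` with `π ∣ D^{(p−1)/4} − c`, `c = i^k` by `eq_of_isUnit`),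
then `sum_pow_mul_pow_rec (c̄ π) (c π̄)` with `c c̄ π π̄ = p`.  w4 file: B («a_{p^k}(E_D) all p»). Why it might fail:
fourth-power-freeness is exactly what makes every `p ∣ D` additive (else `a_p ≠ 0 = T_φ(p)`). [cite: IrelandRosen1990, Ch. 18 §4, Theorem 5] -/
theorem stub_lFunction_quarticModel_prime_pow {D : ℤ} (hD : D ≠ 0) (h4 : ∀ p : ℕ, p.Prime → ¬ ((p : ℤ) ^ 4 ∣ D)) :
    (∀ (p : ℕ), p.Prime → (p : ℤ) ∣ 2 * D → ∀ j : ℕ, (quarticModel D).LFunction (p ^ (j + 1)) = 0) ∧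
      (∀ (q : ℕ) [Fact q.Prime], q % 4 = 3 → ¬ (q : ℤ) ∣ D → ∀ j : ℕ,
        (quarticModel D).LFunction (q ^ (2 * j)) = (-(q : ℤ)) ^ j ∧
          (quarticModel D).LFunction (q ^ (2 * j + 1)) = 0) ∧
      (∀ (p : ℕ) [Fact p.Prime] (hp1 : p % 4 = 1), ¬ (p : ℤ) ∣ D →
        ∀ (π : GaussianInt), IsPrimary π → ∀ (hπp : π.norm = p) (j : ℕ),
          (((quarticModel D).LFunction (p ^ j) : ℤ) : GaussianInt) =
            ∑ i ∈ Finset.range (j + 1),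
              (star (chi hp1 hπp (D : ZMod p)) * π) ^ i * (chi hp1 hπp (D : ZMod p) * star π) ^ (j - i)) := by
  sorry

/-- **Q6 `stub_lFunction_eq_twistedPrimarySum` (S–M): the dictionary `a_n(V) = T_{(D/·)₄}(n)`, `n ≥ 1`** — port of
`lFunction_congruentNumberCurve_eq_jacobiSym_mul_primarySum` (`Nat.recOnPosPrimePosCoprime`: Q3/Q4 against Q5 case by
case, `isMultiplicative_LFunction`), transported to `V = e • E_D` by `WeierstrassCurve.LFunction_smul` (`E_D` is elliptic
since `V` is).  w4 file: B («a_n(E_D) = Σ_{x primary, N x = n} conj((D/x)₄)·x») + D. Why it might fail: it does not, given Q3–Q5.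
[cite: IrelandRosen1990, Ch. 18 §6, Theorem 7 (second half)] -/
theorem stub_lFunction_eq_twistedPrimarySum (V : WeierstrassCurve ℚ) [V.IsElliptic] {D : ℤ}
    (e : WeierstrassCurve.VariableChange ℚ) (hD : D ≠ 0) (h4 : ∀ p : ℕ, p.Prime → ¬ ((p : ℤ) ^ 4 ∣ D))
    (hV : V = e • quarticModel D) {φ : GaussianInt → GaussianInt} (hφ : QuarticCharSpec D φ)
    {n : ℕ} (hn : n ≠ 0) :
    ((V.LFunction n : ℤ) : GaussianInt) = twistedPrimarySum φ n := by
  sorry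

/-- **Q7 `stub_coeff_psi` (M−): `c_{Ψ_{φ,χ'}}(n) = 4 χ'(n) T_φ(n)`** — port of `sum_normEq_primary` / `coeff_heckePsi`:
`Ψ(x) x = χ'(N x) \overline{φ(x̃)} x̃`, every primary `y` of norm `n` is `x̃` for exactly its four associates
(`filter_primary_eq_image`, `card_units4`), and `x̃ = 0` on `1 + i ∣ x`.  Needs no property of `φ`.  w4 file: C.
Why it might fail: it does not. [cite: IrelandRosen1990, Ch. 18 §6, Theorem 7] -/
theorem stub_coeff_psi (φ : GaussianInt → GaussianInt) {m : ℕ} [NeZero m] (χ' : DirichletCharacter ℂ m) (n : ℕ) :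
    GaussianTheta.coeff (psi φ χ') n = 4 * χ' n * ((twistedPrimarySum φ n : GaussianInt) : ℂ) := by
  sorry

/-- **Q8a `stub_psi'_periodic` (M−): `Ψ'` is periodic modulo any `M'` with `8|A| ∣ M'`, `m ∣ M'`** — port of
`heckePsi_add_mul`: `u(x + M' y) = u(x)` (`primaryUnit_add_natCast_mul`, `4 ∣ M'`), `(x + M'y)~ = x̃ + 8|A|·(…)` and
`QuarticCharSpec.periodic` (odd `x`; for even `x` both sides vanish with `u = 0`), `N(x + M'y) ≡ N x (mod m)`
(`norm_add_natCast_mul_emod`).  w4 file: C. Why it might fail: it does not. [cite: IrelandRosen1990, Ch. 18 §6, Theorem 7] -/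
theorem stub_psi'_periodic {A : ℤ} {φ : GaussianInt → GaussianInt} (hφ : QuarticCharSpec A φ) (k : ℕ)
    {m : ℕ} [NeZero m] (χ' : DirichletCharacter ℂ m) {M' : ℕ} (h8 : 8 * A.natAbs ∣ M') (hmM : m ∣ M')
    (x y : GaussianInt) : psi' φ k χ' (x + (M' : GaussianInt) * y) = psi' φ k χ' x := by
  sorry

/-- **Q8b `stub_psi'_isIntegral` (S): the values of `Ψ'` are algebraic integers** (`(u/3)₄^k ∈ {0, ±1}`, `χ'`-values are
roots of unity or `0` — tree `ModularForms.isIntegral_dirichletCharacter_apply` —, Gaussian integers are integral).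
w4 file: C. Why it might fail: it does not. [folklore] -/
theorem stub_psi'_isIntegral (φ : GaussianInt → GaussianInt) (k : ℕ) {m : ℕ} [NeZero m]
    (χ' : DirichletCharacter ℂ m) (x : GaussianInt) : IsIntegral ℤ (psi' φ k χ' x) := by
  sorry

/-- **Q8c `stub_psi_threeSplit` (S–M): the `3`-part splits off pointwise**: for `D = (−3)^k A`,
`Ψ_{(D/·)₄, χ'}(x) = \overline{(x/3)₄}^k · Ψ'_{(A/·)₄,k,χ'}(x)` — on odd `x`: `(D/x̃)₄ = (−3/x̃)₄^k (A/x̃)₄` (landed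
`quarticSymbolInt_mul_left`, `quarticSymbolInt_pow_left`), `(−3/x̃)₄ = (x̃/3)₄` (Q2), `(x̃/3)₄ = (u/3)₄ (x/3)₄` (landed
`quarticCharThree_mul`), `(u/3)₄ = u² ∈ {±1}` real (landed `quarticCharThree_of_isUnit`), `GaussianInt.toComplex_star`,
`toComplex_quarticCharThree`; on even `x` both sides are `0` (`u = 0`) — and `(·/3)₄` is periodic mod `3` (table).
w4 file: C («the 3-part conj(χ₄)^k split»). Why it might fail: it does not. [folklore] -/
theorem stub_psi_threeSplit {D A : ℤ} {k : ℕ} (hDA : D = (-3) ^ k * A) {m : ℕ} [NeZero m]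
    (χ' : DirichletCharacter ℂ m) :
    (∀ x : GaussianInt,
        psi (GaussianQuarticSymbol.quarticSymbolInt D) χ' x =
          (starRingEnd ℂ (quarticCharThree x)) ^ k * psi' (GaussianQuarticSymbol.quarticSymbolInt A) k χ' x) ∧
      (∀ x y : GaussianInt, quarticCharThree (x + 3 * y) = quarticCharThree x) := by
  sorry

/-! ## §3 Proved glue -/

/-- `D = (−3)^{v₃(D)} · A` with `3 ∤ A`, `A ≠ 0`. -/
theorem exists_eq_neg_three_pow_mul {D : ℤ} (hD : D ≠ 0) :
    ∃ A : ℤ, A ≠ 0 ∧ ¬ (3 : ℤ) ∣ A ∧ D = (-3) ^ (padicValInt 3 D) * A := by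
  haveI : Fact (Nat.Prime 3) := ⟨Nat.prime_three⟩
  obtain ⟨B, hB⟩ := padicValInt_dvd (p := 3) D
  have hB' : D = 3 ^ padicValInt 3 D * B := by simpa using hB
  have h3B : ¬ (3 : ℤ) ∣ B := by
    rintro ⟨C, hC⟩
    have h : ((3 : ℕ) : ℤ) ^ (padicValInt 3 D + 1) ∣ D := by
      refine ⟨C, ?_⟩
      calc D = 3 ^ padicValInt 3 D * B := hB'
        _ = ((3 : ℕ) : ℤ) ^ (padicValInt 3 D + 1) * C := by rw [hC]; push_cast; ring
    rcases (padicValInt_dvd_iff (p := 3) _ D).mp h with h0 | h0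
    · exact hD h0
    · omega
  refine ⟨(-1) ^ padicValInt 3 D * B, ?_, ?_, ?_⟩
  · intro h
    rcases mul_eq_zero.mp h with h1 | h1
    · exact pow_ne_zero _ (by norm_num) h1
    · exact hD (by rw [hB', h1, mul_zero])
  · intro h
    exact h3B ((isUnit_one.neg.pow _).dvd_mul_left.mp h)
  · rw [← mul_assoc, ← mul_pow]
    norm_num
    exact hB'

/-- **Q9 (proved): a periodic theta coefficient whose `L`-series coefficients are `4 χ'(n) aₙ(f)` gives
`L(f ⊗ χ', s) = ¼ Θ-L_M(Ψ)(s)` for `re s > 3/2`** (`GaussianTheta.thetaLFunction_eq_LSeries`, termwise). -/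
theorem twistedLSeries_eq_theta {N : ℕ} [NeZero N] (f : CuspForm (Gamma0 N) 2) {m : ℕ}
    (χ' : DirichletCharacter ℂ m) (M : ℕ) [NeZero M] (Ψ : GaussianInt → ℂ)
    (hΨ : ∀ x y : GaussianInt, Ψ (x + (M : GaussianInt) * y) = Ψ x)
    (hcoeff : ∀ n : ℕ, n ≠ 0 → GaussianTheta.coeff Ψ n = 4 * χ' n * cuspCoeff f n)
    {s : ℂ} (hs : 3 / 2 < s.re) :
    twistedLSeries f χ' s = (1 / 4 : ℂ) * GaussianTheta.thetaLFunction M Ψ s := by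
  rw [GaussianTheta.thetaLFunction_eq_LSeries M Ψ hΨ hs, twistedLSeries, LSeries, LSeries, ← tsum_mul_left]
  congr 1
  funext n
  simp only [LSeries.term]
  split_ifs with hn
  · rw [mul_zero]
  · rw [hcoeff n hn]
    ring

/-! ## §4 The composition: the g8 interface `stub_quarticThetaDictionary`, sorry-free from Q1–Q8 -/

/-- **P1b `quarticThetaDictionary` = g8 `stub_quarticThetaDictionary` VERBATIM, proved from the stubs Q1–Q8.**
With `k = v₃(D)`, `D = (−3)^k A`: `φ_D = (D/·)₄`, `φ_A = (A/·)₄` (`quarticSymbolInt`, interface by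
`quarticCharSpec_quarticSymbolInt`), `M' = 8|A|·m`, `Ψ' = psi' (A/·)₄ k χ⁻¹`; the `L`-series identity is Q9 for
`Ψ = psi (D/·)₄ χ⁻¹ = \overline{(·/3)₄}^k Ψ'` (Q8c), periodic mod `3M'` (Q8a + Q8c), with coefficients `4 χ⁻¹(n) aₙ`
(Q7 + Q6 + `IsNewformOf`).  = w4 File D. -/
theorem quarticThetaDictionary (V : WeierstrassCurve ℚ) [V.IsElliptic] [V.IsGloballyMinimal] {D : ℤ}
    (e : WeierstrassCurve.VariableChange ℚ) (hD : D ≠ 0) (h3 : (3 : ℤ) ∣ D)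
    (h4 : ∀ p : ℕ, p.Prime → ¬ ((p : ℤ) ^ 4 ∣ D))
    (hV : V = e • (⟨0, 0, 0, -(D : ℚ), 0⟩ : WeierstrassCurve ℚ))
    {N : ℕ} [NeZero N] (f : CuspForm (Gamma0 N) 2) (hf : IsNewformOf V f)
    (m : ℕ) [NeZero m] (hm : m.Coprime (3 * N)) (χ : DirichletCharacter ℂ m) (hχ : χ.IsPrimitive) :
    ∃ (M' : ℕ) (_ : NeZero (3 * M')) (Ψ' : GaussianInt → ℂ),
      ¬ 3 ∣ M' ∧ 4 ∣ M' ∧ m ∣ M' ∧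
      (∀ x y : GaussianInt, Ψ' (x + (M' : GaussianInt) * y) = Ψ' x) ∧
      (∀ x : GaussianInt, IsIntegral ℤ (Ψ' x)) ∧
      (∀ s : ℂ, 2 < s.re →
        twistedLSeries f χ⁻¹ s =
          (1 / 4 : ℂ) * Literature.NumberTheory.LFunctions.GaussianTheta.thetaLFunction (3 * M')
            (fun x ↦ (starRingEnd ℂ (quarticCharThree x)) ^ (padicValInt 3 D) * Ψ' x) s) := by
  -- `D = (-3)^k A`, `3 ∤ A`, `A ≠ 0`
  obtain ⟨A, hA0, hA3, hDA⟩ := exists_eq_neg_three_pow_mul hD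
  set k : ℕ := padicValInt 3 D with hk
  -- the symbols `φ_D = (D/·)₄`, `φ_A = (A/·)₄` and their interfaces
  have hφD : QuarticCharSpec D (GaussianQuarticSymbol.quarticSymbolInt D) := quarticCharSpec_quarticSymbolInt hD
  have hφA : QuarticCharSpec A (GaussianQuarticSymbol.quarticSymbolInt A) := quarticCharSpec_quarticSymbolInt hA0
  -- the modulus `M' = 8|A| m`
  have hm0 : m ≠ 0 := NeZero.ne m
  have hm3 : ¬ 3 ∣ m := by
    intro h
    have h3 : Nat.Coprime m 3 := (Nat.coprime_mul_iff_right.mp hm).1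
    exact absurd (Nat.Coprime.eq_one_of_dvd h3.symm h) (by norm_num)
  have hA3' : ¬ 3 ∣ A.natAbs := fun h ↦ hA3 (Int.natCast_dvd.mpr h)
  set M' : ℕ := 8 * A.natAbs * m with hM'
  have hM'0 : M' ≠ 0 := mul_ne_zero (mul_ne_zero (by norm_num) (Int.natAbs_ne_zero.mpr hA0)) hm0
  haveI hM'3 : NeZero (3 * M') := ⟨mul_ne_zero (by norm_num) hM'0⟩
  have h3M' : ¬ 3 ∣ M' := by
    intro h
    rcases (Nat.Prime.dvd_mul Nat.prime_three).mp h with h | h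
    · rcases (Nat.Prime.dvd_mul Nat.prime_three).mp h with h | h
      · omega
      · exact hA3' h
    · exact hm3 h
  have h4M' : 4 ∣ M' := ⟨2 * A.natAbs * m, by rw [hM']; ring⟩
  have hmM' : m ∣ M' := Dvd.intro_left _ rfl
  have h8M' : 8 * A.natAbs ∣ M' := Dvd.intro _ rfl
  -- `Ψ'` and the pointwise `3`-splitting of `Ψ = psi (D/·)₄ χ⁻¹`
  obtain ⟨hsplit, hper3⟩ := stub_psi_threeSplit hDA χ⁻¹
  have hperΨ' : ∀ x y : GaussianInt,
      psi' (GaussianQuarticSymbol.quarticSymbolInt A) k χ⁻¹ (x + (M' : GaussianInt) * y) =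
        psi' (GaussianQuarticSymbol.quarticSymbolInt A) k χ⁻¹ x :=
    fun x y ↦ stub_psi'_periodic hφA k χ⁻¹ h8M' hmM' x y
  -- periodicity of `Ψ` modulo `3 M'`
  have hperΨ : ∀ x y : GaussianInt,
      psi (GaussianQuarticSymbol.quarticSymbolInt D) χ⁻¹ (x + ((3 * M' : ℕ) : GaussianInt) * y) =
        psi (GaussianQuarticSymbol.quarticSymbolInt D) χ⁻¹ x := by
    intro x y
    rw [hsplit, hsplit x]
    have h1 : quarticCharThree (x + ((3 * M' : ℕ) : GaussianInt) * y) = quarticCharThree x := by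
      have : x + ((3 * M' : ℕ) : GaussianInt) * y = x + 3 * ((M' : GaussianInt) * y) := by push_cast; ring
      rw [this, hper3]
    have h2 : psi' (GaussianQuarticSymbol.quarticSymbolInt A) k χ⁻¹ (x + ((3 * M' : ℕ) : GaussianInt) * y) =
        psi' (GaussianQuarticSymbol.quarticSymbolInt A) k χ⁻¹ x := by
      have : x + ((3 * M' : ℕ) : GaussianInt) * y = x + (M' : GaussianInt) * (3 * y) := by push_cast; ring
      rw [this, hperΨ']
    rw [h1, h2]
  -- the coefficients `c_Ψ(n) = 4 χ⁻¹(n) aₙ(f)`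
  have hcoeff : ∀ n : ℕ, n ≠ 0 →
      GaussianTheta.coeff (psi (GaussianQuarticSymbol.quarticSymbolInt D) χ⁻¹) n = 4 * χ⁻¹ n * cuspCoeff f n := by
    intro n hn
    have hV' : V = e • quarticModel D := hV
    rw [stub_coeff_psi, hf.2 n, ← stub_lFunction_eq_twistedPrimarySum V e hD h4 hV' hφD hn, map_intCast]
  refine ⟨M', hM'3, psi' (GaussianQuarticSymbol.quarticSymbolInt A) k χ⁻¹, h3M', h4M', hmM', hperΨ',
    fun x ↦ stub_psi'_isIntegral _ k χ⁻¹ x, fun s hs ↦ ?_⟩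
  have hs' : 3 / 2 < s.re := by linarith
  rw [twistedLSeries_eq_theta f χ⁻¹ (3 * M') _ hperΨ hcoeff hs']
  congr 2
  funext x
  exact hsplit x

end Summit.BirchSwinnertonDyer.BirchSwinnertonDyer.Cruxes.InertBadAtThree.RubinE1InertThree.QuarticDictionary

end
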